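import Summits.HodgeConjecture.HodgeConjecture.Theorems.HeckePrymWeilAimedDescendingOfAimedSplitProduct
import Summits.HodgeConjecture.HodgeConjecture.Theorems.HeckePrymWeilAimedDescendingProductFrame
import Summits.HodgeConjecture.HodgeConjecture.Theorems.HeckePrymWeilAimedDescendingProductModel
import Summits.HodgeConjecture.HodgeConjecture.Theorems.HeckePrymWeilAimedDescendingWeilTypeModel
import Summits.HodgeConjecture.HodgeConjecture.Theorems.HeckePrymWeilAimedDescendingRationalModel
import Literature.AlgebraicGeometry.Motives.AimedSplitProductProofs
import Literature.AlgebraicGeometry.Motives.AbelianVarietyCohomologyExteriorH1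
import HarnessLib

/-!
# Crux `WeilSixfoldsSqrtMinus7` (stmt-HodgeConjecture-1260), line `hyperbolic-eightfold-descent` — sub-goal `stub_cmSurfaceModel` of Stub 7 (aimed partner at `d = 7`)

The RATIONAL DEGREE-ONE MODEL of the CM Weil surface of the product trick at `d = 7`. Given a
complex elliptic curve `E` (an `AbelianVariety ℂ` of dimension `1`) with an endomorphism `ι`,
`ι ≫ ι = -7` (i.e. `√-7 ∈ End E`; both are HYPOTHESES here, the curve is built elsewhere), the
surface `B = E × E` with `ψ = ι × (-ι) = prodLift (fst ≫ ι) (snd ≫ (-ι))` and the weighted product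
polarisation classes `y = r m₁ · pr₁^* ω + r m₂ · pr₂^* ω` (`ω = α ∪ β` the rational generator of
`H²(E(ℂ); ℂ)`) is van Geemen's "`E × E` with `K = ℚ(√-7)` acting through `(ι, ῑ)` and the
polarisation `m₁ E₁ ⊞ m₂ E₁`" (LNM 1594, 5.3; Markman arXiv:2509.23403 §11.5 Step 2, the partner
`(A₂, η₂, h₂)`). `stub_cmSurfaceModel` produces exactly the data consumed for the factor `B` by
`Theorems.isHyperbolicWeilType_prod_of_rationalModels` (file VI of item 14643):

* a rational `ℂ`-basis `(α, β)` of `H¹(E(ℂ); ℂ)` with `α ∪ β ≠ 0` and the rational matrix `ME` of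
  `ι^*` in it (column convention `ι^* eᵢ = Σⱼ ME j i • eⱼ`), `ME² = -7`
  (`Theorems.exists_rationalModel_one`; `dim H¹ = 2`, `Motives.AbelianVariety.finrank_complexBetti_one`;
  `(ι^*)² = (ι ≫ ι)^* = -7` on `H¹`, `complexBetti_map_map_one_of_comp_self`);
* `ψ ≫ ψ = -7` (`Theorems.prodLift_comp_self_eq_neg_zsmul` with `(-ι) ≫ (-ι) = ι ≫ ι`);
* the Künneth frame `w = (pr₁^* α, pr₁^* β) ⊔ (pr₂^* α, pr₂^* β)` of `H¹((E × E)(ℂ); ℂ)`: rational,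
  `ℂ`-independent (`Theorems.linearIndependent_sumElim_map_fst_map_snd`), with `ψ^*`-matrix
  `ME ⊕ (-ME)` (`Theorems.map_prodLift_sumElim`, `(-ι)^* = -ι^*` on `H¹`);
* the rational non-zero top class `ωB = pr₁^* ω ∪ pr₂^* ω` (`cupProduct_map_fst_map_snd_ne_zero`);
* for every `r ∈ ℚ`, `m₁ m₂ ∈ ℕ`: `y` is rational, `ψ^* y = 7 y` (`ι^* = (-ι)^* = deg = 7` on the top
  cohomology `H²(E(ℂ); ℂ)`, `Theorems.map_top_eq_pow_smul`), the Gram matrix of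
  `Q_{y,1}(w_k, w_l) = y ∪ w_k ∪ w_l` is `(m₂ r)·J ⊕ (m₁ r)·J`, `J = [[0,1],[-1,0]]`, with respect to
  `ωB` (`Theorems.polarizationPairingOne_sumElim` with `jA = jB = 0` and the degree-one Gram matrix
  `J` of the basis `(α, β)`: `α ∪ α = β ∪ β = 0`, `β ∪ α = -(α ∪ β)`), and `y ∪ y = 2 m₁ m₂ r² · ωB`
  (`Theorems.lefschetzPow_add_map_self`).

Helper lemmas (this file): in a basis `(e₀, e₁)` of `H¹`, `x ∪ y = (x₀ y₁ - x₁ y₀) · e₀ ∪ e₁`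
(`cupProduct_eq_det_smul_of_basis_two`); on a curve `e₀ ∪ e₁ ≠ 0` (`cupProduct_basis_ne_zero_of_dim_one`,
from `H² = ⋀² H¹`, `Motives.AbelianVariety.hasExteriorCohomologyH1_complexPoints`, and `dim H² = 1`);
the degree-one Gram matrix of a basis is `J` (`polarizationPairingOne_zero_basis_two`); and
`M² = -d` for the matrix of `φ^*`, `φ ≫ φ = -d`, in any `ℂ`-independent family
(`mulVec_mulVec_eq_neg_smul_of_comp_self`).

Everything is proved from theorems of the tree; no named fact is used.

Sources: B. van Geemen, *An introduction to the Hodge conjecture for abelian varieties*, LNM 1594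
(1994), Lemma 5.2 (2)–(3), 5.3, 5.4; E. Markman, arXiv:2509.23403, §11.5 Step 2; Ch. Birkenhake,
H. Lange, *Complex Abelian Varieties*, Lemma 1.1.17; A. Hatcher, *Algebraic Topology*, Thm. 3.11,
Thm. 3.16.
-/

noncomputable section

-- single-problem summit (Problem = Summit): the mandated namespace repeats `HodgeConjecture`.
set_option linter.dupNamespace false

open CategoryTheory
open Literature.AlgebraicGeometry Literature.AlgebraicGeometry.Motives
  Literature.AlgebraicGeometry.HodgeTheory Literature.AlgebraicTopology.SingularHomology
  Literature.Geometry.Kaehler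

namespace Summit.HodgeConjecture.HodgeConjecture.Theorems.WeilSixfoldsSqrtMinus7.HyperbolicEightfoldDescent

/-! ### Degree-one cup products in a basis of two classes -/

/-- **In a basis `(e₀, e₁)` of `H¹(X(ℂ); ℂ)`, `x ∪ y = (x₀ y₁ - x₁ y₀) · (e₀ ∪ e₁)`** (bilinearity,
`v ∪ v = 0` and `e₁ ∪ e₀ = -(e₀ ∪ e₁)` for degree-one classes: graded commutativity, Hatcher
Thm. 3.11). Stated for any proof `h : 1 + 1 = n` of the degree bookkeeping. [cite: HatcherAT2002, Thm. 3.11] -/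
theorem cupProduct_eq_det_smul_of_basis_two {X : Motives.SchemeOver ℂ}
    (B : Module.Basis (Fin 2) ℂ (complexBetti X 1)) {n : ℕ} (h : 1 + 1 = n) (x y : complexBetti X 1) :
    cupProduct h x y =
      (B.repr x 0 * B.repr y 1 - B.repr x 1 * B.repr y 0) • cupProduct h (B 0) (B 1) := by
  have hself : ∀ v : complexBetti X 1, cupProduct h v v = 0 := by
    subst h
    exact cup_self_deg_one
  have hcomm : cupProduct h (B 1) (B 0) = -cupProduct h (B 0) (B 1) := by
    rw [cupProduct_gradedComm_holds ℂ _ h h (B 1) (B 0)]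
    simp
  conv_lhs => rw [← B.sum_repr x, ← B.sum_repr y]
  simp only [Fin.sum_univ_two, map_add, map_smul, LinearMap.add_apply, LinearMap.smul_apply, hself,
    hcomm, smul_zero, zero_add, add_zero, smul_neg]
  module

/-- **On a curve the cup product of a basis of `H¹` is non-zero**: for a complex abelian variety
`E` of dimension `1` and a `ℂ`-basis `(e₀, e₁)` of `H¹(E(ℂ); ℂ)`, `e₀ ∪ e₁ ≠ 0` — `H²(E(ℂ); ℂ)` is
spanned by products of degree-one classes (`H• = ⋀• H¹`,
`Motives.AbelianVariety.hasExteriorCohomologyH1_complexPoints`), all of which are multiples of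
`e₀ ∪ e₁` (`cupProduct_eq_det_smul_of_basis_two`), and `dim H²(E(ℂ); ℂ) = 1`
(`Theorems.finrank_complexBetti_two_add_two_mul_eq_one`). [cite: LangeBirkenhake1992, Lemma 1.1.17] -/
theorem cupProduct_basis_ne_zero_of_dim_one {E : AbelianVariety ℂ} (hdim : E.dim = 1)
    (B : Module.Basis (Fin 2) ℂ (complexBetti E.X 1)) :
    cupProduct (rfl : 1 + 1 = 2) (B 0) (B 1) ≠ 0 := by
  intro h0
  have hE : Motives.IsSmoothProjective (0 + 1) E.X :=
    Theorems.isSmoothProjective_of_dim_eq' (m := 0 + 1) hdim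
  have hΛ := Motives.AbelianVariety.hasExteriorCohomologyH1_complexPoints E
  have hspan2 : Submodule.span ℂ (Set.range (cupPowOne ℂ (Motives.ComplexPoints E.X) 2)) = ⊤ :=
    hΛ.span_range_cupPowOne 2
  have hall : ∀ v : Fin 2 → complexBetti E.X 1, cupPowOne ℂ (Motives.ComplexPoints E.X) 2 v = 0 := by
    intro v
    rw [cupPowOne_succ, cupPowOne_one, cupProduct_eq_det_smul_of_basis_two B]
    change _ • cupProduct (rfl : 1 + 1 = 2) (B 0) (B 1) = 0
    rw [h0, smul_zero]
  have hbot : Submodule.span ℂ (Set.range (cupPowOne ℂ (Motives.ComplexPoints E.X) 2)) = ⊥ := by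
    rw [Submodule.span_eq_bot]
    rintro _ ⟨v, rfl⟩
    exact hall v
  have h1 := Theorems.finrank_complexBetti_two_add_two_mul_eq_one hE
  change Module.finrank ℂ (complexBetti E.X 2) = 1 at h1
  have h0' : Module.finrank ℂ (complexBetti E.X 2) = 0 := by
    rw [← finrank_top ℂ (complexBetti E.X 2), ← hspan2, hbot, finrank_bot]
  omega

/-- **The degree-one Gram matrix of a basis `(e₀, e₁)` of `H¹` is `J = [[0, 1], [-1, 0]]`**:
`Q_{h,0}(eᵢ, eⱼ) = eᵢ ∪ eⱼ = J i j · (e₀ ∪ e₁)` for every class `h ∈ H²` (the exponent is `0`, so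
`h` does not enter). [folklore] -/
theorem polarizationPairingOne_zero_basis_two {X : Motives.SchemeOver ℂ}
    (B : Module.Basis (Fin 2) ℂ (complexBetti X 1)) (h2 : complexBetti X 2) (i j : Fin 2) :
    polarizationPairingOne X h2 0 (B i) (B j) =
      ((!![(0 : ℚ), 1; -1, 0] i j : ℚ) : ℂ) • cupProduct (rfl : 1 + 1 = 2) (B 0) (B 1) := by
  rw [polarizationPairingOne_apply, lefschetzPow_zero, LinearMap.id_apply,
    cupProduct_eq_det_smul_of_basis_two B, B.repr_self, B.repr_self]
  fin_cases i <;> fin_cases j <;> simp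

/-- **`M² = -d` for the rational matrix of `φ^*` on `H¹`, `φ ≫ φ = -d`**: if `u` is a
`ℂ`-independent family in `H¹(A(ℂ); ℂ)` and `φ^* uᵢ = Σ_k M k i • u_k`, then `M (M v) = -d v` for
every `v` — because `(φ^*)² = (φ ≫ φ)^* = (-d)^* = -d` on `H¹` (degree-one classes are primitive;
the tree's `complexBetti_map_map_one_of_comp_self`) and coefficients in an independent family are
unique. [cite: vanGeemen1994HodgeAV, 4.9 and Lemma 5.2] -/
theorem mulVec_mulVec_eq_neg_smul_of_comp_self {A : AbelianVariety ℂ} {d : ℕ} {φ : A ⟶ A}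
    (hφ : φ ≫ φ = -(d • 𝟙 A)) {ι : Type*} [Fintype ι] [DecidableEq ι]
    {u : ι → complexBetti A.X 1} (hui : LinearIndependent ℂ u) (M : Matrix ι ι ℚ)
    (hM : ∀ i, complexBetti.map φ.hom.hom.hom 1 (u i) = ∑ j, ((M j i : ℚ) : ℂ) • u j) (v : ι → ℚ) :
    M.mulVec (M.mulVec v) = -((d : ℚ) • v) := by
  have hcoef : ∀ i k, (M * M) k i = if k = i then -(d : ℚ) else 0 := by
    intro i
    have h1 : complexBetti.map φ.hom.hom.hom 1 (complexBetti.map φ.hom.hom.hom 1 (u i)) =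
        ∑ k, (((M * M) k i : ℚ) : ℂ) • u k := by
      rw [hM i, map_sum]
      simp_rw [map_smul, hM, Finset.smul_sum, smul_smul]
      rw [Finset.sum_comm]
      simp_rw [← Finset.sum_smul, Matrix.mul_apply, Rat.cast_sum, Rat.cast_mul, mul_comm]
    rw [complexBetti_map_map_one_of_comp_self hφ] at h1
    have h2 : ∑ k, ((((M * M) k i : ℚ) : ℂ) - if k = i then (-(d : ℂ)) else 0) • u k = 0 := by
      simp_rw [sub_smul, Finset.sum_sub_distrib, ← h1, ite_smul, zero_smul, Finset.sum_ite_eq',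
        if_pos (Finset.mem_univ _), neg_smul]
      abel
    intro k
    have h3 := Fintype.linearIndependent_iff.1 hui _ h2 k
    rw [sub_eq_zero] at h3
    have h4 : (((M * M) k i : ℚ) : ℂ) = ((if k = i then -(d : ℚ) else 0 : ℚ) : ℂ) := by
      rw [h3]; split_ifs <;> norm_num
    exact_mod_cast h4
  rw [Matrix.mulVec_mulVec]
  ext k
  rw [Matrix.mulVec, Pi.neg_apply, Pi.smul_apply]
  change ∑ i, (M * M) k i * v i = _
  simp_rw [hcoef]
  simp [Finset.sum_ite_eq]

/-! ### The rational degree-one model of `(E × E, ι × (-ι), m₁ E₁ ⊞ m₂ E₁)` -/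

/-- **The rational degree-one model of the CM Weil surface `(E × E, ι × (-ι))` with the weighted
product polarisations** (van Geemen, LNM 1594, Lemma 5.2 (2)–(3) and 5.3: "`E × E` with `K`
acting through `(ι, ῑ)` and the polarisation `m₁ E₁ ⊞ m₂ E₁`"; Markman §11.5 Step 2). For a complex
abelian variety `E` of dimension `1` and `ι : E ⟶ E` with `ι ≫ ι = -7` there are: a rational
`ℂ`-basis `(α, β)` of `H¹(E(ℂ); ℂ)` with `α ∪ β ≠ 0`, the rational matrix `ME` of `ι^*` in it
(`ι^* eᵢ = Σⱼ ME j i • eⱼ`, `ME² = -7`), the Künneth frame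
`w = (pr₁^*α, pr₁^*β) ⊔ (pr₂^*α, pr₂^*β)` of `H¹((E × E)(ℂ); ℂ)` (rational, `ℂ`-independent, with
`ψ^*`-matrix `ME ⊕ (-ME)` for `ψ = prodLift (fst ≫ ι) (snd ≫ (-ι))`, `ψ ≫ ψ = -7`) and the rational
non-zero top class `ωB = pr₁^*ω ∪ pr₂^*ω`, `ω = α ∪ β`, such that for all `r ∈ ℚ`, `m₁ m₂ ∈ ℕ` the
class `y = r m₁ · pr₁^*ω + r m₂ · pr₂^*ω` is rational, `ψ^* y = 7 y`, its polarisation pairing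
`Q_{y,1}(w_k, w_l) = y ∪ w_k ∪ w_l` has Gram matrix `(m₂ r)·J ⊕ (m₁ r)·J` (`J = [[0,1],[-1,0]]`) with
respect to `ωB`, and `y ∪ y = 2 m₁ m₂ r² · ωB`. Proof: module docstring (rational basis from
`Theorems.exists_rationalModel_one`, `dim H¹ = 2`; `α ∪ β ≠ 0` from `H² = ⋀² H¹`; `ME² = -7` from
`(ι^*)² = -7` on `H¹`; `ι^* = (-ι)^* = 7` on `H²(E)`; block Gram matrix and top power from
`Theorems.polarizationPairingOne_sumElim`, `Theorems.lefschetzPow_add_map_self` with `jA = jB = 0`).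
[cite: vanGeemen1994HodgeAV, Lemma 5.2 (2)–(3) and 5.3] [cite: Markman2025SurveySecant, §11.5 Step 2] -/
theorem stub_cmSurfaceModel :
    ∀ (E : AbelianVariety ℂ) (ι : E ⟶ E), E.dim = 1 → ι ≫ ι = -((7 : ℤ) • 𝟙 E) →
      ∃ (α β : complexBetti E.X 1) (ME : Matrix (Fin 2) (Fin 2) ℚ)
        (w : Fin 2 ⊕ Fin 2 → complexBetti (E.prod E).X 1) (ωB : complexBetti (E.prod E).X (2 + 2 * 1)),
        IsRationalClass α ∧ IsRationalClass β ∧ LinearIndependent ℂ ![α, β] ∧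
        Submodule.span ℂ (Set.range ![α, β]) = ⊤ ∧
        cupProduct (rfl : 1 + 1 = 2) α β ≠ 0 ∧
        (∀ v, ME.mulVec (ME.mulVec v) = -((7 : ℚ) • v)) ∧
        (∀ i, complexBetti.map ι.hom.hom.hom 1 (![α, β] i) = ∑ j, ((ME j i : ℚ) : ℂ) • ![α, β] j) ∧
        AbelianVariety.prodLift (AbelianVariety.fst E E ≫ ι) (AbelianVariety.snd E E ≫ (-ι)) ≫
            AbelianVariety.prodLift (AbelianVariety.fst E E ≫ ι) (AbelianVariety.snd E E ≫ (-ι)) =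
          -((7 : ℤ) • 𝟙 (E.prod E)) ∧
        w = Sum.elim (fun i => complexBetti.map (AbelianVariety.fst E E).hom.hom.hom 1 (![α, β] i))
              (fun i => complexBetti.map (AbelianVariety.snd E E).hom.hom.hom 1 (![α, β] i)) ∧
        (∀ k, IsRationalClass (w k)) ∧ LinearIndependent ℂ w ∧
        (∀ k, complexBetti.map (AbelianVariety.prodLift (AbelianVariety.fst E E ≫ ι)
              (AbelianVariety.snd E E ≫ (-ι))).hom.hom.hom 1 (w k) =
            ∑ l, ((Matrix.fromBlocks ME 0 0 (-ME) l k : ℚ) : ℂ) • w l) ∧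
        ωB = cupProduct (rfl : 2 + 2 = 2 + 2 * 1)
              (complexBetti.map (AbelianVariety.fst E E).hom.hom.hom 2 (cupProduct (rfl : 1 + 1 = 2) α β))
              (complexBetti.map (AbelianVariety.snd E E).hom.hom.hom 2 (cupProduct (rfl : 1 + 1 = 2) α β)) ∧
        IsRationalClass ωB ∧ ωB ≠ 0 ∧
        ∀ (r : ℚ) (m₁ m₂ : ℕ), ∃ y : complexBetti (E.prod E).X 2,
          y = ((r * m₁ : ℚ) : ℂ) •
                complexBetti.map (AbelianVariety.fst E E).hom.hom.hom 2 (cupProduct (rfl : 1 + 1 = 2) α β) +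
              ((r * m₂ : ℚ) : ℂ) •
                complexBetti.map (AbelianVariety.snd E E).hom.hom.hom 2 (cupProduct (rfl : 1 + 1 = 2) α β) ∧
          IsRationalClass y ∧
          complexBetti.map (AbelianVariety.prodLift (AbelianVariety.fst E E ≫ ι)
              (AbelianVariety.snd E E ≫ (-ι))).hom.hom.hom 2 y = (7 : ℂ) • y ∧
          (∀ k l, polarizationPairingOne (E.prod E).X y 1 (w k) (w l) =
            ((Matrix.fromBlocks (((m₂ : ℚ) * r) • !![(0 : ℚ), 1; -1, 0]) 0 0
                (((m₁ : ℚ) * r) • !![(0 : ℚ), 1; -1, 0]) k l : ℚ) : ℂ) • ωB) ∧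
          lefschetzPow y 1 2 y = ((2 * m₁ * m₂ * r * r : ℚ) : ℂ) • ωB := by
  classical
  intro E ι hdim hι
  -- dimension and Weil-pair bookkeeping
  have hdim' : E.dim = 0 + 1 := hdim
  have hE : Motives.IsSmoothProjective (0 + 1) E.X := Theorems.isSmoothProjective_of_dim_eq' hdim'
  have hι7 : ι ≫ ι = -(7 • 𝟙 E) := by rw [hι, ofNat_zsmul]
  have hnegι7 : (-ι) ≫ (-ι) = -(7 • 𝟙 E) := by rw [Preadditive.neg_comp_neg, hι7]
  have hrank : Module.finrank ℂ (complexBetti E.X 1) = 2 * E.dim :=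
    Motives.AbelianVariety.finrank_complexBetti_one E
  have hΛ := Motives.AbelianVariety.hasExteriorCohomologyH1_complexPoints E
  have hspan0 :
      Submodule.span ℂ (Set.range (cupPowOne ℂ (Motives.ComplexPoints E.X) (2 + 2 * 0))) = ⊤ :=
    hΛ.span_range_cupPowOne _
  -- Step 1: a rational basis of `H¹(E(ℂ); ℂ)` and the rational matrix of `ι^*`
  obtain ⟨n, u, M, _, _, _, hu, hui, husp, hM, -, -, -, -⟩ :=
    Theorems.exists_rationalModel_one ι hdim' (0 : complexBetti E.X 2) IsRationalClass.zero
  haveI : Module.Finite ℂ (complexBetti E.X 1) := finite_complexBetti_abelianVariety E 1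
  have hn : n = 2 := by
    have h := Module.finrank_eq_card_basis
      (Module.Basis.mk hui (by rw [husp]) : Module.Basis (Fin n) ℂ (complexBetti E.X 1))
    rw [Fintype.card_fin, hrank, hdim] at h
    omega
  subst hn
  obtain ⟨α, β, rfl⟩ : ∃ α β, u = ![α, β] :=
    ⟨u 0, u 1, by funext i; fin_cases i <;> rfl⟩
  let B : Module.Basis (Fin 2) ℂ (complexBetti E.X 1) := Module.Basis.mk hui (by rw [husp])
  have hB0 : B 0 = α := by simp [B]
  have hB1 : B 1 = β := by simp [B]
  -- Step 2: `ω = α ∪ β` is rational and non-zero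
  have hωrat : IsRationalClass (cupProduct (rfl : 1 + 1 = 2) α β) := (hu 0).cup _ (hu 1)
  have hω0 : cupProduct (rfl : 1 + 1 = 2) α β ≠ 0 := by
    have h := cupProduct_basis_ne_zero_of_dim_one hdim B
    rwa [hB0, hB1] at h
  have hGram : ∀ (h2 : complexBetti E.X 2) (i j : Fin 2),
      polarizationPairingOne E.X h2 0 (![α, β] i) (![α, β] j) =
        ((!![(0 : ℚ), 1; -1, 0] i j : ℚ) : ℂ) • cupProduct (rfl : 1 + 1 = 2) α β := by
    intro h2 i j
    have h := polarizationPairingOne_zero_basis_two B h2 i j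
    have hBi : ∀ i, B i = ![α, β] i := fun i => Module.Basis.mk_apply hui _ i
    rwa [hBi, hBi, hB0, hB1] at h
  -- Step 3: `ι^*` and `(-ι)^*` act by `7` on `H²(E(ℂ); ℂ)`
  have h7 : ∀ x : complexBetti E.X 2, complexBetti.map ι.hom.hom.hom 2 x = (7 : ℂ) • x :=
    fun x => by
      have h := Theorems.map_top_eq_pow_smul hdim' hrank hspan0 (d := 7) (by norm_num) hι7 x
      simpa using h
  have h7' : ∀ x : complexBetti E.X 2, complexBetti.map (-ι).hom.hom.hom 2 x = (7 : ℂ) • x :=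
    fun x => by
      have h := Theorems.map_top_eq_pow_smul hdim' hrank hspan0 (d := 7) (by norm_num) hnegι7 x
      simpa using h
  -- Step 4: the matrix of `(-ι)^*` is `-ME`
  have hMneg : ∀ k, complexBetti.map (-ι).hom.hom.hom 1 (![α, β] k) =
      ∑ l, (((-M) l k : ℚ) : ℂ) • ![α, β] l := by
    intro k
    rw [complexBetti_map_neg_deg_one, hM k, ← Finset.sum_neg_distrib]
    simp [neg_smul]
  -- assembly
  refine ⟨α, β, M,
    Sum.elim (fun i => complexBetti.map (AbelianVariety.fst E E).hom.hom.hom 1 (![α, β] i))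
      (fun i => complexBetti.map (AbelianVariety.snd E E).hom.hom.hom 1 (![α, β] i)),
    cupProduct (rfl : 2 + 2 = 2 + 2 * 1)
      (complexBetti.map (AbelianVariety.fst E E).hom.hom.hom 2 (cupProduct (rfl : 1 + 1 = 2) α β))
      (complexBetti.map (AbelianVariety.snd E E).hom.hom.hom 2 (cupProduct (rfl : 1 + 1 = 2) α β)),
    by simpa using hu 0, by simpa using hu 1, hui, husp, hω0, ?_, hM, ?_, rfl,
    ?_, Theorems.linearIndependent_sumElim_map_fst_map_snd hui hui,
    Theorems.map_prodLift_sumElim ι (-ι) ![α, β] M hM ![α, β] (-M) hMneg, rfl, ?_, ?_, ?_⟩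
  · -- `ME² = -7`
    intro v
    exact_mod_cast mulVec_mulVec_eq_neg_smul_of_comp_self hι7 hui M hM v
  · -- `ψ ≫ ψ = -7`
    exact_mod_cast Theorems.prodLift_comp_self_eq_neg_zsmul (p := 7) (φ := ι) (ψ := -ι)
      (by exact_mod_cast hι) (by rw [Preadditive.neg_comp_neg]; exact_mod_cast hι)
  · -- rationality of the frame
    rintro (i | i)
    · exact (hu i).map _
    · exact (hu i).map _
  · -- rationality of `ωB`
    exact (hωrat.map _).cup _ (hωrat.map _)
  · -- `ωB ≠ 0` (Künneth uniqueness)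
    exact cupProduct_map_fst_map_snd_ne_zero (Y := E.X) (Z := E.X) hE hE (k := 4) (q := 2)
      (by norm_num) (by norm_num) hω0 hω0
  · -- the weighted product classes
    intro r m₁ m₂
    set ω := cupProduct (rfl : 1 + 1 = 2) α β with hω
    set hA2 : complexBetti E.X 2 := ((r * m₁ : ℚ) : ℂ) • ω with hA2def
    set hB2 : complexBetti E.X 2 := ((r * m₂ : ℚ) : ℂ) • ω with hB2def
    have hdA : lefschetzPow hA2 0 2 hA2 = ((r * m₁ : ℚ) : ℂ) • ω := rfl
    have hdB : lefschetzPow hB2 0 2 hB2 = ((r * m₂ : ℚ) : ℂ) • ω := rfl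
    have hA2rat : IsRationalClass hA2 := hωrat.smul _
    have hB2rat : IsRationalClass hB2 := hωrat.smul _
    clear_value hA2 hB2
    refine ⟨complexBetti.map (AbelianVariety.fst E E).hom.hom.hom 2 hA2 +
        complexBetti.map (AbelianVariety.snd E E).hom.hom.hom 2 hB2, ?_, ?_, ?_, ?_, ?_⟩
    · rw [hA2def, hB2def, map_smul, map_smul]
    · exact (hA2rat.map _).add (hB2rat.map _)
    · rw [map_add, Theorems.map_prodLift_map_fst, Theorems.map_prodLift_map_snd, h7, h7',
        map_smul, map_smul, smul_add]
    · intro k l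
      rw [Theorems.polarizationPairingOne_sumElim hdim' hdim' (m := 1) (by norm_num) ![α, β]
        ![α, β] hA2 ω _ (hGram hA2) (r * m₁) hdA hB2 ω _ (hGram hB2) (r * m₂) hdB k l]
      congr 1
      have e1 : ((Nat.choose 1 0 : ℕ) : ℚ) * (r * (m₂ : ℚ)) = (m₂ : ℚ) * r := by
        simp [mul_comm]
      have e2 : ((Nat.choose 1 (0 + 1) : ℕ) : ℚ) * (r * (m₁ : ℚ)) = (m₁ : ℚ) * r := by
        simp [mul_comm]
      rw [e1, e2]
    · rw [Theorems.lefschetzPow_add_map_self hdim' hdim' (m := 1) (by norm_num) hA2 ω (r * m₁) hdA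
        hB2 ω (r * m₂) hdB]
      congr 1
      push_cast
      have e3 : ((Nat.choose (1 + 1) (0 + 1) : ℕ) : ℂ) = 2 := by norm_num
      rw [e3]
      ring

end Summit.HodgeConjecture.HodgeConjecture.Theorems.WeilSixfoldsSqrtMinus7.HyperbolicEightfoldDescent

end
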